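import Mathlib.Analysis.Analytic.Constructions
import Mathlib.Analysis.SpecialFunctions.Exponential

/-!
# `Balaban1983to89.B9Eq350GroupPencilLettersEntire` — T. Bałaban, *Propagators for lattice gauge theories in a background field*, Commun. Math. Phys.
# **99** (1985) 389–434 [Balaban1985BackgroundPropagators] Thm 3.4 p. 400, (3.50)–(3.52) p. 400: **THE GROUP PENCIL'S LETTERS `z ↦ U·e^{zA}` AND
# `z ↦ e^{−zA}·U⁻¹` ARE ENTIRE, `Ring.inverse (U·e^{zA}) = e^{−zA}·U⁻¹` (the HOLOMORPHIC continuation of `U*`, not the adjoint of the complex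
# background), AND EVERY WORD IN THEM (holonomy, parallel transport, `adTransport`) IS ENTIRE** — abstract complete normed `ℂ`-algebra letters; the
# analyticity input `hDa` of the sibling `B9Eq386GreenGroupPencilEnergy` (N54), next to the defect input of `B9Eq350GroupPencilWordDefect`

statement-level skeleton of published theorems with citation tags; proofs where landed; nothing here is a claim about the Yang–Mills mass gap

CITATION HEADER (lean-in-tree rule).  Audit cell `pub-balaban`, sub-cell `t4`, BINDER row NE9; filed by NE9 formalisation-swarm LEAF PROVER 01
(`b2b-balaban-t4-ne9-formalise-leaf-01`, gen 89) under the crux-ideation seat t4-ne9-idea-1 gen 153's located note N54 («THE GROUP PENCIL IS TYPE (B)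
TOO»; cell journal 2026-08-25 l.64371 ∕ l.64788; card `t4/ideate/NE9/lens1-g153/N54-GROUP-PENCIL-g153.md`), leaf-01 named first.  CREDIT: the mechanism AND
the Lean text are t4-ne9-idea-1 g153's scratch kernel `NE9GroupPencilTypeB` (ccac8e3be9f51d84, §2; NOT-TO-FILE under the cell's FREEZE (0)), ported token
for token; namespace, header and docstring locators are this seat's.  Sources READ first-hand in the held text layer
(`paper:balaban1985-cmp99-background-propagators`, journal page = PDF page + 388): p. 400 Thm 3.4 *«the operators G₁(U), (Q′(U)G′₂(U)Q′*(U))⁻¹, R(U),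
G(U) extend to configurations U′U for α′₁ ≤ a₁ as analytic functions of A»*, `U′ = e^{iηA}`, `A` *«with values in the complexified Lie algebra g^c»*;
(3.50) `(Δ_{U′U}λ)(x) = η⁻²(2dλ(x) − Σ_{b∈st(x)} exp(iη ad_{A′(b)})R(U_b)λ(b₊))`; (3.51)–(3.52) *«hence F′_{1,k}(i ad_{A′(b)}) is an analytic function of
A(b)»*.  In the tree the same sentence is kernel-checked on a lattice carrier by `B9Eq352Analytic` (cell `lit-balaban`) and for the Neumann series by
`B9Eq386NeumannAnalytic`; this file is the carrier-free Banach-algebra letter level the N54 pencil consumes, and asserts nothing beyond it.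

WHY THIS FILE (cell context, N54 §2).  The sibling `B9Eq386GreenGroupPencilEnergy` inverts the analytic pencil `S₀ + D(z)` given `D` analytic on a
disc.  At the lattice `D(z) = H_κ(U·e^{z•ηA}) − H_κ(U)` and every matrix coefficient of `H_κ(U·e^{z•ηA})` is a finite sum of WORDS in the letters
`U(b)e^{zηA(b)}`, `e^{−zηA(b)}U(b)⁻¹` and `z`-constants (the Combes–Thomas weights `e^{±κ•M}`, averaging profiles), so analyticity of `D` is: the two
letters are entire (`analyticAt_mul_exp_smul`, `analyticAt_exp_neg_smul_mul`), the second IS the algebra inverse of the first (`inverse_mul_exp_smul`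
— for a unit `U` of ANY norm; at a unitary real base point `U⁻¹ = U*`, and the continuation of `U*` is `e^{−zA}U⁻¹`, NOT `(U e^{zA})*`), and finite
noncommutative products of analytic functions are analytic (`analyticAt_list_prod`).  Finite sums and `z`-constants are Mathlib's; the lattice
bookkeeping is the junction's, NOT here.

WHAT IS PROVED (sorry-free; proof lane — no `def`; [folklore] Banach-algebra `exp` + Mathlib analytic constructions;
`[NormedRing 𝔸] [NormedAlgebra ℂ 𝔸] [CompleteSpace 𝔸]`).
* `analyticAt_exp_smul` (`z ↦ exp(z•A)`), **`analyticAt_mul_exp_smul`** (`z ↦ U·exp(z•A)`), `analyticAt_exp_neg_smul_mul` (`z ↦ exp(−z•A)·V`),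
  **`inverse_mul_exp_smul`** (`U : 𝔸ˣ` ⟹ `Ring.inverse (U·exp(z•A)) = exp(−z•A)·U⁻¹`), `mul_exp_smul_mul_inverse` (`(U·e^{zA})·(e^{−zA}·U⁻¹) = 1`),
  **`analyticAt_list_prod`** (`∀ f ∈ l, AnalyticAt ℂ f z` ⟹ `w ↦ (l.map (· w)).prod` analytic at `z`; `CompleteSpace` not needed), and the
  `adTransport` word `(U e^{zA})·X·(e^{−zA}U⁻¹)` as an `example`.
MODEL ∕ HONEST SCOPE.  (M1) abstract letters; no lattice object, no carrier.  (M2) nothing displayed beyond `U, A, z`.  (M3) one complex parameter `z`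
(the pencil); joint holomorphy in `A ∈ 𝔤^ℂ` (Hartogs) NOT typed.  (M4) nothing of [B9] Thm 3.1 ∕ 3.3 ∕ 3.4 asserted, valued or discharged.  NOT NE9
(cell pub-balaban: NE9 NOT PRINTED ∕ NOT PROVED; «NE9 ⇐ the named binders»; row WALLED ON A MODEL (O-NE9-1; #5 UNRULED); spine PROVED 0∕9; rung (B)+1
on a finite T⁴ — NOT infinite volume, NOT mass gap, NOT BetaPertH, NOT Clay).  HONEST DEPENDENCY (cell line): continuum YM on T⁴ ⇐ BetaPertH ∧ nine
spine estimates (0/9 proved); BetaPertH ⇐ (D1) ∧ (D4) ∧ CAP+tail; G-an2-4 gates asym, D1 and NE2/3/4.  NEW file; nothing modified.  Net new unproved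
facts: 0.
-/

noncomputable section

open NormedSpace

namespace Literature.MathematicalPhysics.QuantumFieldTheory.Balaban1983to89.B9Eq350GroupPencilLettersEntire

/-! ## §1 The letters and their words are entire (abstract complete normed `ℂ`-algebra: matrices, `E →L[ℂ] E`, …) -/

section Letters

variable {𝔸 : Type*} [NormedRing 𝔸] [NormedAlgebra ℂ 𝔸] [CompleteSpace 𝔸]

/-- `z ↦ exp(z•A)` is entire. [folklore] [cite: Balaban1985BackgroundPropagators, Thm 3.4 p.400 (`U′ = e^{iηA}`)] -/
theorem analyticAt_exp_smul (A : 𝔸) (z : ℂ) : AnalyticAt ℂ (fun w : ℂ => exp (w • A)) z := by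
  have h1 : AnalyticAt ℂ (fun w : ℂ => w • A) z := analyticAt_id.smul analyticAt_const
  have h2 : AnalyticAt ℂ (fun x : 𝔸 => exp x) (z • A) := exp_analytic (z • A)
  exact h2.comp_of_eq h1 rfl

/-- **THE BOND LETTER** `z ↦ U·exp(z•A)` is entire. [folklore]
[cite: Balaban1985BackgroundPropagators, Thm 3.4 p.400 (`U′U`, `U′ = e^{iηA}`, `A ∈ g^c`), (3.50) p.400] -/
theorem analyticAt_mul_exp_smul (U A : 𝔸) (z : ℂ) : AnalyticAt ℂ (fun w : ℂ => U * exp (w • A)) z :=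
  analyticAt_const.mul (analyticAt_exp_smul A z)

/-- **THE CONTINUED INVERSE LETTER** `z ↦ exp(−z•A)·V` is entire. [folklore] [cite: Balaban1985BackgroundPropagators, Thm 3.4 p.400, (3.50) p.400] -/
theorem analyticAt_exp_neg_smul_mul (V A : 𝔸) (z : ℂ) : AnalyticAt ℂ (fun w : ℂ => exp (-(w • A)) * V) z := by
  have h1 : AnalyticAt ℂ (fun w : ℂ => exp (w • (-A))) z := analyticAt_exp_smul (-A) z
  have h2 : (fun w : ℂ => exp (-(w • A))) = fun w : ℂ => exp (w • (-A)) := by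
    funext w; rw [smul_neg]
  rw [← h2] at h1
  exact h1.mul analyticAt_const

/-- **`Ring.inverse (U·exp(z•A)) = exp(−z•A)·U⁻¹`** for a unit `U`: the HOLOMORPHIC continuation of `U*` along the group pencil (it is NOT the
adjoint of the complex background `U·exp(z•A)` unless `z•A` is skew). [folklore] [cite: Balaban1985BackgroundPropagators, Thm 3.4 p.400, (3.50) p.400] -/
theorem inverse_mul_exp_smul (U : 𝔸ˣ) (A : 𝔸) (z : ℂ) :
    Ring.inverse ((U : 𝔸) * exp (z • A)) = exp (-(z • A)) * ↑U⁻¹ := by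
  letI : NormedAlgebra ℚ 𝔸 := NormedAlgebra.restrictScalars ℚ ℂ 𝔸
  have he : IsUnit (exp (z • A)) := isUnit_exp _
  have h1 : ((U : 𝔸) * exp (z • A)) = ((U * he.unit : 𝔸ˣ) : 𝔸) := by
    rw [Units.val_mul, he.unit_spec]
  rw [h1, Ring.inverse_unit, mul_inv_rev, Units.val_mul]
  congr 1
  rw [← Ring.inverse_unit, he.unit_spec, Ring.inverse_exp]

/-- The continued inverse letter IS a two-sided inverse: `(U·exp(z•A))·(exp(−z•A)·U⁻¹) = 1`. [folklore]
[cite: Balaban1985BackgroundPropagators, Thm 3.4 p.400] -/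
theorem mul_exp_smul_mul_inverse (U : 𝔸ˣ) (A : 𝔸) (z : ℂ) :
    ((U : 𝔸) * exp (z • A)) * (exp (-(z • A)) * ↑U⁻¹) = 1 := by
  letI : NormedAlgebra ℚ 𝔸 := NormedAlgebra.restrictScalars ℚ ℂ 𝔸
  have he : exp (z • A) * exp (-(z • A)) = 1 := by
    rw [← Ring.inverse_exp, Ring.mul_inverse_cancel _ (isUnit_exp _)]
  calc ((U : 𝔸) * exp (z • A)) * (exp (-(z • A)) * ↑U⁻¹) = (U : 𝔸) * (exp (z • A) * exp (-(z • A))) * ↑U⁻¹ := by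
        noncomm_ring
    _ = 1 := by rw [he, mul_one, Units.mul_inv]

omit [CompleteSpace 𝔸] in
/-- **EVERY WORD IS ENTIRE**: a finite (noncommutative) product of functions analytic at `z` is analytic at `z` — holonomies, parallel
transports and `adTransport` words in the pencil letters and constants. [folklore] [cite: Balaban1985BackgroundPropagators, Thm 3.4 p.400, (3.50)–(3.52) p.400] -/
theorem analyticAt_list_prod {l : List (ℂ → 𝔸)} {z : ℂ} (h : ∀ f ∈ l, AnalyticAt ℂ f z) :
    AnalyticAt ℂ (fun w => (l.map fun f => f w).prod) z := by
  induction l with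
  | nil => simpa using analyticAt_const
  | cons f l ih =>
    have hf : AnalyticAt ℂ f z := h f (by simp)
    have hl : AnalyticAt ℂ (fun w => (l.map fun g => g w).prod) z := ih fun g hg => h g (by simp [hg])
    simp only [List.map_cons, List.prod_cons]
    exact hf.mul hl

end Letters

/-! ## §2 Non-vacuity: the `adTransport` word -/

section NonVacuity

/-- The `adTransport` word of the pencil, `z ↦ (U·exp(z•A))·X·(exp(−z•A)·U⁻¹)`, is entire (§1 composed; print's `exp(iη ad_{A′(b)})R(U_b)` letter). [folklore]
[cite: Balaban1985BackgroundPropagators, (3.50) p.400 (`exp(iη ad_{A′(b)})R(U_b)`)] -/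
example {𝔸 : Type*} [NormedRing 𝔸] [NormedAlgebra ℂ 𝔸] [CompleteSpace 𝔸] (U : 𝔸ˣ) (A X : 𝔸) (z : ℂ) :
    AnalyticAt ℂ (fun w : ℂ => ((U : 𝔸) * exp (w • A)) * X * (exp (-(w • A)) * ↑U⁻¹)) z :=
  ((analyticAt_mul_exp_smul (U : 𝔸) A z).mul analyticAt_const).mul (analyticAt_exp_neg_smul_mul (↑U⁻¹) A z)

end NonVacuity

end Literature.MathematicalPhysics.QuantumFieldTheory.Balaban1983to89.B9Eq350GroupPencilLettersEntire

end
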